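import Literature.NumberTheory.DiophantineGeometry.GenEllGaloisImageUp
import Literature.NumberTheory.DiophantineGeometry.GenEllGaloisImageBaseChange
import Literature.NumberTheory.EllipticCurves.VariableChangePointsMap
import Mathlib.AlgebraicGeometry.EllipticCurve.NormalForms
import HarnessLib

/-!
# The Galois image on `E[l]` contains `SL₂(𝔽_l)` for one model iff for every twist (`j ≠ 0, 1728`)

S. Mochizuki, *Inter-universal Teichmüller theory IV*, RIMS manuscript (Apr. 2020; = PRIMS **57**
(2021)), Cor. 2.2 (ii) (P6) p. 46 and Thm. 1.10 p. 22: condition (P6) — "the image of the outer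
homomorphism `Gal(Q̄/F) → GL₂(𝔽_l)` determined by the `l`-torsion points of `E_F` contains the subgroup
`SL₂(𝔽_l)`" — is stated in the proof of Cor. 2.2 for the Legendre model `y² = x(x−1)(x−λ)` over the
theta-field, while the initial Θ-data of Thm. 1.10 are built on "any model of `E_F ×_F F̄` over `F_mod`"
(p. 22, via Prop. 1.8 (ii), (iii)) — a TWIST of the Legendre curve in general.  Under the standing
hypothesis of Cor. 2.2 that `E_F` admits an `F`-core (so `j(E) ∉ {0, 1728}`, p. 43) twists are quadratic
(Silverman *AEC* X.5.4), and the classical fact PROVED in this theorem-only file (no definitions, no named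
facts) is that (P6) does not see them:

* `EllPoint.imageModLContainsSL2_of_variableChange_eq` — (P6) is invariant under a change of Weierstrass
  model over the same field (`C • W₁ = W₂`; the substitution is a `Γ_K`-equivariant isomorphism of the
  geometric points, the tree's `VariableChange.pointEquivBaseChange`);
* `WeierstrassCurve.exists_variableChange_of_j_eq_of_isShortNF` — two short Weierstrass models
  `y² = x³ + A x + B` with the same `j ∉ {0, 1728}` become isomorphic by `(x, y) ↦ (u²x, u³y)` over any
  field containing a square root `u` of `(B₁A₂)/(B₂A₁)` (Silverman *AEC* X.5.4: the twist is quadratic);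
* `EllPoint.imageModLContainsSL2_of_j_eq` — for elliptic curves `W₁, W₂` over a number field `K` with
  `j(W₁) = j(W₂) ∉ {0, 1728}` and a prime `l ≠ 2`: if the image of `Gal(K̄/K)` on `W₁[l]` contains
  `SL₂(𝔽_l)` then so does its image on `W₂[l]` (short normal forms over `K`; the quadratic field `K(u)`,
  Galois of degree `≤ 2` — prime to `l`; UP by `imageModLContainsSL2_map_of_isGalois_of_not_dvd`, across
  by the isomorphism, DOWN by the tree's `imageModLContainsSL2_of_baseChange`).

## References

* S. Mochizuki, op. cit., Cor. 2.2 (ii) (P6) p. 46; Thm. 1.10 p. 22; Prop. 1.8 (ii)(iii) pp. 18–19.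
  [Mochizuki2012]
* J. H. Silverman, *The Arithmetic of Elliptic Curves*, III.1 Table 3.1, X.5.4. [SilvermanAEC2009]
-/

noncomputable section

open WeierstrassCurve Field Polynomial

/-! ## Twists of short Weierstrass models with the same `j ∉ {0, 1728}` are quadratic -/

namespace WeierstrassCurve

/-- **Two short Weierstrass models `y² = x³ + Aᵢx + Bᵢ` with the same `j`-invariant `∉ {0, 1728}` are
isomorphic over any field containing `u` with `u² = (B₁A₂)/(B₂A₁)`**, via the change of variables
`(u, 0, 0, 0)`: indeed `j₁ = j₂` reads `A₁³B₂² = A₂³B₁²`, whence `u⁴ = A₁/A₂` and `u⁶ = B₁/B₂`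
(Silverman *AEC* X.5.4: for `j ≠ 0, 1728` the twists are quadratic).
[cite: SilvermanAEC2009, Prop. X.5.4] -/
theorem exists_variableChange_of_j_eq_of_isShortNF {K : Type*} [Field K] [CharZero K]
    (W₁ W₂ : WeierstrassCurve K) [W₁.IsElliptic] [W₂.IsElliptic] [W₁.IsShortNF] [W₂.IsShortNF]
    (hj : W₁.j = W₂.j) (h0 : W₁.j ≠ 0) (h1728 : W₁.j ≠ 1728)
    {L : Type*} [Field L] [Algebra K L] (u : L)
    (hu : u ^ 2 = algebraMap K L (W₁.a₆ * W₂.a₄ / (W₂.a₆ * W₁.a₄))) :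
    ∃ C : VariableChange L, C • (W₁.map (algebraMap K L)) = W₂.map (algebraMap K L) := by
  -- the coefficients and their non-vanishing
  have hΔ₁ : 4 * W₁.a₄ ^ 3 + 27 * W₁.a₆ ^ 2 ≠ 0 := by
    intro h
    apply W₁.isUnit_Δ.ne_zero
    rw [W₁.Δ_of_isShortNF, h, mul_zero]
  have hΔ₂ : 4 * W₂.a₄ ^ 3 + 27 * W₂.a₆ ^ 2 ≠ 0 := by
    intro h
    apply W₂.isUnit_Δ.ne_zero
    rw [W₂.Δ_of_isShortNF, h, mul_zero]
  have hj₁ := W₁.j_of_isShortNF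
  have hj₂ := W₂.j_of_isShortNF
  have hA₁ : W₁.a₄ ≠ 0 := by
    intro h; apply h0; rw [hj₁, h]; simp
  have hB₁ : W₁.a₆ ≠ 0 := by
    intro h; apply h1728; rw [hj₁, h]
    field_simp
    ring
  have h0' : W₂.j ≠ 0 := hj ▸ h0
  have h1728' : W₂.j ≠ 1728 := hj ▸ h1728
  have hA₂ : W₂.a₄ ≠ 0 := by
    intro h; apply h0'; rw [hj₂, h]; simp
  have hB₂ : W₂.a₆ ≠ 0 := by
    intro h; apply h1728'; rw [hj₂, h]
    field_simp
    ring
  -- `j₁ = j₂` ⟺ `A₁³B₂² = A₂³B₁²`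
  have hrel : W₁.a₄ ^ 3 * W₂.a₆ ^ 2 = W₂.a₄ ^ 3 * W₁.a₆ ^ 2 := by
    rw [hj₁, hj₂, div_eq_div_iff hΔ₁ hΔ₂] at hj
    linear_combination hj / (6912 * 27)
  -- in `L`
  set f := algebraMap K L with hf
  have hfinj : Function.Injective f := f.injective
  have hA₁' : f W₁.a₄ ≠ 0 := (map_ne_zero_iff f hfinj).mpr hA₁
  have hA₂' : f W₂.a₄ ≠ 0 := (map_ne_zero_iff f hfinj).mpr hA₂
  have hB₁' : f W₁.a₆ ≠ 0 := (map_ne_zero_iff f hfinj).mpr hB₁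
  have hB₂' : f W₂.a₆ ≠ 0 := (map_ne_zero_iff f hfinj).mpr hB₂
  have hrel' : f W₁.a₄ ^ 3 * f W₂.a₆ ^ 2 = f W₂.a₄ ^ 3 * f W₁.a₆ ^ 2 := by
    have := congrArg f hrel
    simpa only [map_mul, map_pow] using this
  have hu' : u ^ 2 * (f W₂.a₆ * f W₁.a₄) = f W₁.a₆ * f W₂.a₄ := by
    rw [hu, map_div₀, map_mul, map_mul, div_mul_cancel₀]
    exact mul_ne_zero hB₂' hA₁'
  have hu0 : u ≠ 0 := by
    intro h
    rw [h, zero_pow two_ne_zero, zero_mul] at hu'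
    exact mul_ne_zero hB₁' hA₂' hu'.symm
  have hu4 : u ^ 4 * f W₂.a₄ = f W₁.a₄ := by
    have e1 : u ^ 4 = (u ^ 2) ^ 2 := by ring
    -- from `hu'`: `u² = (B₁A₂)/(B₂A₁)`; `u⁴ A₂ = A₁` ⟺ `B₁²A₂³ = B₂²A₁³`
    have key : (u ^ 2 * (f W₂.a₆ * f W₁.a₄)) ^ 2 * f W₂.a₄ =
        (f W₂.a₆ * f W₁.a₄) ^ 2 * (u ^ 4 * f W₂.a₄) := by ring
    rw [hu'] at key
    have key2 : (f W₂.a₆ * f W₁.a₄) ^ 2 * (u ^ 4 * f W₂.a₄) =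
        (f W₂.a₆ * f W₁.a₄) ^ 2 * f W₁.a₄ := by
      rw [← key]; linear_combination hrel'.symm
    exact mul_left_cancel₀ (pow_ne_zero 2 (mul_ne_zero hB₂' hA₁')) key2
  have hu6 : u ^ 6 * f W₂.a₆ = f W₁.a₆ := by
    have key : (u ^ 2 * (f W₂.a₆ * f W₁.a₄)) ^ 3 * f W₂.a₆ =
        (f W₂.a₆ * f W₁.a₄) ^ 3 * (u ^ 6 * f W₂.a₆) := by ring
    rw [hu'] at key
    have key2 : (f W₂.a₆ * f W₁.a₄) ^ 3 * (u ^ 6 * f W₂.a₆) =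
        (f W₂.a₆ * f W₁.a₄) ^ 3 * f W₁.a₆ := by
      rw [← key]; linear_combination f W₁.a₆ * f W₂.a₆ * hrel'.symm
    exact mul_left_cancel₀ (pow_ne_zero 3 (mul_ne_zero hB₂' hA₁')) key2
  refine ⟨⟨Units.mk0 u hu0, 0, 0, 0⟩, ?_⟩
  ext
  · simp [variableChange_a₁]
  · simp [variableChange_a₂]
  · simp [variableChange_a₃]
  · simp only [variableChange_a₄, map_a₁, map_a₂, map_a₃, map_a₄, W₁.a₁_of_isShortNF,
      W₁.a₂_of_isShortNF, W₁.a₃_of_isShortNF, map_zero, mul_zero, sub_zero, add_zero,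
      Units.val_inv_eq_inv_val, Units.val_mk0]
    rw [← hu4, inv_pow]
    field_simp
    ring
  · simp only [variableChange_a₆, map_a₁, map_a₂, map_a₃, map_a₄, map_a₆, W₁.a₁_of_isShortNF,
      W₁.a₂_of_isShortNF, W₁.a₃_of_isShortNF, map_zero, mul_zero, sub_zero, add_zero, zero_mul,
      Units.val_inv_eq_inv_val, Units.val_mk0]
    rw [← hu6, inv_pow]
    field_simp
    ring

end WeierstrassCurve

namespace Literature.NumberTheory.DiophantineGeometry.GenEll

namespace EllPoint

open Literature.NumberTheory.EllipticCurves Literature.NumberTheory.GaloisRepresentations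

/-! ## (P6) is invariant under a change of model over the same field -/

/-- **(P6) does not depend on the Weierstrass model**: for `C • W₁ = W₂` over a number field `K`, if
every determinant-one `𝔽_l`-linear endomorphism of `W₁[l](K̄)` is a Galois element then the same holds
for `W₂[l](K̄)` — the substitution is a `Γ_K`-equivariant isomorphism `W₁(K̄) ≃ W₂(K̄)`
(`VariableChange.pointEquivBaseChange`). [cite: SilvermanAEC2009, III.3.1(b)] -/
theorem imageModLContainsSL2_of_variableChange_eq {K : Type} [Field K] [NumberField K]
    {W₁ W₂ : WeierstrassCurve K} [h₁ : W₁.IsElliptic] [h₂ : W₂.IsElliptic] (C : VariableChange K)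
    (hW : C • W₁ = W₂) (l : ℕ) [NeZero l] (h : ({ F := K, W := W₁ } : EllPoint).ImageModLContainsSL2 l) :
    ({ F := K, W := W₂ } : EllPoint).ImageModLContainsSL2 l := by
  classical
  subst hW
  set Kb := AlgebraicClosure K with hKb
  set e : geomPoints W₁ ≃+ geomPoints (C • W₁) :=
    VariableChange.pointEquivBaseChange W₁ C Kb with he
  have he_smul : ∀ (σ : absoluteGaloisGroup K) (Q : geomPoints W₁), e (σ • Q) = σ • e Q := by
    intro σ Q
    exact VariableChange.pointEquivBaseChange_map_algEquiv W₁ C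
      (absoluteGaloisGroup.toAlgEquiv K σ) Q
  set V₁ := W₁.geomTorsion (l : ℤ) with hV₁
  set V₂ := (C • W₁).geomTorsion (l : ℤ) with hV₂
  have hmem₂ : ∀ Q : V₁, e (Q : geomPoints W₁) ∈ V₂ := by
    intro Q
    show _ ∈ (C • W₁).geomTorsion (l : ℤ)
    rw [AddSubgroup.torsionBy.nsmul_iff, ← map_nsmul, AddSubgroup.torsionBy.nsmul_iff.mp Q.2, map_zero]
  have hmem₁ : ∀ Q : V₂, e.symm (Q : geomPoints (C • W₁)) ∈ V₁ := by
    intro Q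
    show _ ∈ W₁.geomTorsion (l : ℤ)
    rw [AddSubgroup.torsionBy.nsmul_iff, ← map_nsmul, AddSubgroup.torsionBy.nsmul_iff.mp Q.2, map_zero]
  set eT : V₁ ≃+ V₂ :=
    { toFun := fun Q => ⟨e Q, hmem₂ Q⟩
      invFun := fun Q => ⟨e.symm Q, hmem₁ Q⟩
      left_inv := fun Q => Subtype.ext (e.symm_apply_apply _)
      right_inv := fun Q => Subtype.ext (e.apply_symm_apply _)
      map_add' := fun Q Q' => Subtype.ext (by simp) } with heT
  have heT_coe : ∀ Q, ((eT Q : V₂) : geomPoints (C • W₁)) = e Q := fun Q => rfl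
  have heT_smul : ∀ (σ : absoluteGaloisGroup K) (Q : V₁), eT (σ • Q) = σ • eT Q := by
    intro σ Q
    apply Subtype.ext
    rw [heT_coe, AddSubgroup.torsionBy.coe_smul, AddSubgroup.torsionBy.coe_smul, heT_coe, he_smul]
  letI inst₁ : Module (ZMod l) V₁ := AddSubgroup.torsionBy.zmodModule
  letI inst₂ : Module (ZMod l) V₂ := AddSubgroup.torsionBy.zmodModule
  set Λ : V₁ ≃ₗ[ZMod l] V₂ :=
    { eT.toAddMonoidHom.toZModLinearMap l with
      invFun := eT.symm
      left_inv := fun x => eT.symm_apply_apply x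
      right_inv := fun x => eT.apply_symm_apply x } with hΛ
  have hΛ_apply : ∀ x, Λ x = eT x := fun x => rfl
  have hΛ_symm : ∀ x, Λ.symm x = eT.symm x := fun x => rfl
  intro f hf
  set f₁ : V₁ →ₗ[ZMod l] V₁ := (Λ.symm : V₂ →ₗ[ZMod l] V₁) ∘ₗ f ∘ₗ (Λ : V₁ →ₗ[ZMod l] V₂) with hf₁
  have hf₁det : LinearMap.det f₁ = 1 := by
    have hc := LinearMap.det_conj f Λ.symm
    simp only [LinearEquiv.symm_symm] at hc
    rw [hf₁, hc]; exact hf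
  obtain ⟨σ, hσ⟩ := h f₁ hf₁det
  refine ⟨σ, fun x => ?_⟩
  have hx : x = eT (eT.symm x) := (eT.apply_symm_apply x).symm
  rw [hx, ← heT_smul, hσ, hf₁]
  simp only [LinearMap.coe_comp, LinearEquiv.coe_coe, Function.comp_apply, hΛ_apply, hΛ_symm,
    eT.apply_symm_apply]

/-! ## (P6) is invariant under twists for `j ∉ {0, 1728}` -/

/-- **(P6) is the same for all models with a given `j ∉ {0, 1728}`** (twists are quadratic): for elliptic
curves `W₁, W₂` over a number field `K` with `j(W₁) = j(W₂)`, `j ≠ 0, 1728`, and a prime `l ≠ 2`, if the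
image of `Gal(K̄/K)` on `W₁[l]` contains `SL₂(𝔽_l)` then so does its image on `W₂[l]`.  (Passing to short
normal forms over `K`, the two become isomorphic over `K(u)`, `u² = (B₁A₂)/(B₂A₁)`, a Galois extension of
degree `≤ 2`, prime to `l`: UP, across the isomorphism, and DOWN.) This is why (P6) of Cor. 2.2 (stated for
the Legendre model) holds for the model over `F_mod` of Thm. 1.10 p. 22 once `E_F` admits an `F`-core
(p. 43, `j ∉ {0, 1728}`). [cite: Mochizuki2012, IUTchIV Cor. 2.2 (ii) (P6) p.46] -/
theorem imageModLContainsSL2_of_j_eq {K : Type} [Field K] [NumberField K]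
    (W₁ W₂ : WeierstrassCurve K) [W₁.IsElliptic] [W₂.IsElliptic]
    (hj : W₁.j = W₂.j) (h0 : W₁.j ≠ 0) (h1728 : W₁.j ≠ 1728) (l : ℕ) [Fact l.Prime] (hl2 : l ≠ 2)
    (h : ({ F := K, W := W₁ } : EllPoint).ImageModLContainsSL2 l) :
    ({ F := K, W := W₂ } : EllPoint).ImageModLContainsSL2 l := by
  classical
  have hl : l.Prime := Fact.out
  haveI : Invertible (2 : K) := invertibleOfNonzero two_ne_zero
  haveI : Invertible (3 : K) := invertibleOfNonzero three_ne_zero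
  -- short normal forms over `K`
  obtain ⟨C₁, hC₁⟩ := W₁.exists_variableChange_isShortNF
  obtain ⟨C₂, hC₂⟩ := W₂.exists_variableChange_isShortNF
  haveI := hC₁
  haveI := hC₂
  have hjS : (C₁ • W₁).j = (C₂ • W₂).j := by rw [variableChange_j, variableChange_j, hj]
  have h0S : (C₁ • W₁).j ≠ 0 := by rw [variableChange_j]; exact h0
  have h1728S : (C₁ • W₁).j ≠ 1728 := by rw [variableChange_j]; exact h1728
  have h1 : ({ F := K, W := C₁ • W₁ } : EllPoint).ImageModLContainsSL2 l :=
    imageModLContainsSL2_of_variableChange_eq C₁ rfl l h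
  -- the quadratic field `K(u)`, `u² = d`
  set d : K := (C₁ • W₁).a₆ * (C₂ • W₂).a₄ / ((C₂ • W₂).a₆ * (C₁ • W₁).a₄) with hd
  set Kb := AlgebraicClosure K with hKb
  obtain ⟨u, hu⟩ := IsAlgClosed.exists_pow_nat_eq (algebraMap K Kb d) two_pos
  have hint : IsIntegral K u := Algebra.IsIntegral.isIntegral u
  set K' : IntermediateField K Kb := IntermediateField.adjoin K {u} with hK'
  haveI : FiniteDimensional K K' := IntermediateField.adjoin.finiteDimensional hint
  haveI : NumberField K' := NumberField.of_module_finite K K'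
  -- `p = X² − d` vanishes at `u`, so `[K(u) : K] ≤ 2`
  set p : K[X] := X ^ 2 - Polynomial.C d with hp
  have hp0 : p ≠ 0 := Polynomial.X_pow_sub_C_ne_zero two_pos d
  have hpu : Polynomial.aeval u p = 0 := by
    simp [hp, hu]
  have hdeg : Module.finrank K K' ≤ 2 := by
    rw [hK', IntermediateField.adjoin.finrank hint]
    have h1 := minpoly.degree_le_of_ne_zero K u hp0 hpu
    rw [hp, Polynomial.degree_X_pow_sub_C two_pos] at h1
    exact Polynomial.natDegree_le_iff_degree_le.mpr h1
  have hndvd : ¬ l ∣ Module.finrank K K' := by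
    intro hdvd
    have hpos : 0 < Module.finrank K K' := Module.finrank_pos
    have hle := Nat.le_of_dvd hpos hdvd
    have h2l := hl.two_le
    omega
  -- `K(u)/K` is Galois: it is the splitting field of `p` (roots `±u`)
  have hsplit : (p.map (algebraMap K Kb)).Splits := IsAlgClosed.splits _
  have hKroots : IntermediateField.adjoin K (p.rootSet Kb) = K' := by
    apply le_antisymm
    · rw [IntermediateField.adjoin_le_iff]
      intro r hr
      rw [Polynomial.mem_rootSet] at hr
      have hr2 : r ^ 2 = u ^ 2 := by
        have := hr.2
        simp only [hp, map_sub, map_pow, Polynomial.aeval_X, Polynomial.aeval_C, sub_eq_zero] at this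
        rw [this, hu]
      rcases eq_or_eq_neg_of_sq_eq_sq r u hr2 with h' | h'
      · rw [h']; exact IntermediateField.mem_adjoin_simple_self K u
      · rw [h']; exact neg_mem (IntermediateField.mem_adjoin_simple_self K u)
    · rw [hK', IntermediateField.adjoin_le_iff, Set.singleton_subset_iff]
      exact IntermediateField.subset_adjoin K _ (Polynomial.mem_rootSet.mpr ⟨hp0, hpu⟩)
  haveI : Polynomial.IsSplittingField K K' p :=
    hKroots ▸ IntermediateField.adjoin_rootSet_isSplittingField hsplit
  haveI : Normal K K' := Normal.of_isSplittingField p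
  haveI : IsGalois K K' := isGalois_iff.mpr ⟨inferInstance, inferInstance⟩
  -- UP to `K(u)`
  have h2 := imageModLContainsSL2_map_of_isGalois_of_not_dvd ({ F := K, W := C₁ • W₁ } : EllPoint) K' l
    hndvd h1
  -- across the twist, over `K(u)`
  set u' : K' := ⟨u, IntermediateField.mem_adjoin_simple_self K u⟩ with hu'
  have hu'2 : (u' : K') ^ 2 = algebraMap K K' d := by
    apply Subtype.ext
    show ((u' ^ 2 : K') : Kb) = ((algebraMap K K' d : K') : Kb)
    rw [SubmonoidClass.coe_pow]
    show u ^ 2 = _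
    rw [hu]
    exact IsScalarTower.algebraMap_apply K K' Kb d
  obtain ⟨C, hC⟩ := WeierstrassCurve.exists_variableChange_of_j_eq_of_isShortNF (C₁ • W₁) (C₂ • W₂) hjS
    h0S h1728S (L := K') u' hu'2
  have h3 := imageModLContainsSL2_of_variableChange_eq (K := K') C hC l h2
  -- DOWN to `K`, and back to the model `W₂`
  have h4 : ({ F := K, W := C₂ • W₂ } : EllPoint).ImageModLContainsSL2 l :=
    imageModLContainsSL2_of_baseChange ({ F := K, W := C₂ • W₂ } : EllPoint) K' l h3
  exact imageModLContainsSL2_of_variableChange_eq C₂⁻¹ (inv_smul_smul C₂ W₂) l h4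

end EllPoint

end Literature.NumberTheory.DiophantineGeometry.GenEll

end
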